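import Literature.Computability.AlgebraicComplexity.SmallFormatRankLemma5
import Mathlib.LinearAlgebra.Matrix.Charpoly.Coeff
import Mathlib.FieldTheory.IsAlgClosed.Basic
import HarnessLib

/-!
# Bläser 2003, Lemma 7 for `⟨3,3,3⟩` (normal form of a hypothetical length-18 computation)

Topic `Literature/Computability/AlgebraicComplexity`. Source: M. Bläser, *On the complexity of
the multiplication of matrices of small formats*, J. Complexity 19 (2003) 43–60 [Blaser2003],
Lemma 7 (p. 51) and its proof (pp. 50–51), for `n = m = 3`, `M = 9`, `r = 18`:
if `β` is a computation of length `18` for `⟨3,3,3⟩` over an algebraically closed field, then —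
after equivalence transformations — `g_1, …, g_9` form a basis of `(k^{3×3})^*` and some
`a` with `1 ≤ rk a ≤ 2` lies in `⋂_{μ=10}^{17} ker f_μ` (`lemma7`; we index by finite sets:
a 9-set `Gs` carrying the basis, one distinguished index `ρs ∉ Gs`, and `f_μ(a) = 0` for all
`μ ∉ Gs ∪ {ρs}`).

DEVIATION from the printed proof (documented): Bläser's first step uses his Lemma 6
([Blaser1999, §4], algebraic geometry: `2n - 2 = 4` matrices can be sandwiched into `Z₁`
simultaneously) with the block sizes `6 + 8 + 4`. We use instead the block sizes `3 + 8 + 7`: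
the orthogonal complement of seven `w_ρ` has dimension `≥ 2`, hence (pencil argument,
`exists_singular_of_two_le_finrank`, the only use of algebraic closure) contains a nonzero
SINGULAR `Λ`; with `v Λ = 0`, the rank-one right ideal `R' = v · K^{1×3}` and the hyperplane
`Z = Λ^⊥ ⊇ R'` play the roles of `R^{3,3}` and `Z₁^{3,3}`: for `c` killed by the eight middle
`g_μ`, `b c ∈ Z` for all `b`, so `c` is singular (`exists_mid`). The rest (choice of the dual
basis vector `y_9`, the dichotomy on `dim span{f_9,…,f_18}`, transposition) is as printed
(`exists_y9`, `lemma7`). All PROVED.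

Relation to `SmallFormatRankLemma7.lean` (`blaser2003_lemma7`, the general `⟨n,m,n⟩` Lemma 7 via
Lemma 6, developed in parallel for `blaser2003_thm14`): this file is the self-contained `3 × 3`
instance in the `IsComp`/`frob` language of `SmallFormatRankSetup.lean` used by the discharge of
`blaser2003_cor9` (`SmallFormatRankCor9Proofs.lean`); it does not import or restate that file.
-/

namespace Literature.Computability.AlgebraicComplexity

namespace Blaser2003

open Matrix Module

variable {K : Type*} [Field K]

/-! ## Selecting bases among families of matrices -/

/-- Extending an independent subfamily `s` of `v` inside `t` (with `v(t)` spanning) to a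
9-element subfamily forming a basis of `K^{3×3}` (basis exchange). [folklore] -/
theorem exists_block_extension {ι : Type*} [Fintype ι] (v : ι → Mat3 K) {s t : Finset ι}
    (hs : LinearIndepOn K v s) (hst : s ⊆ t) (ht : ⊤ ≤ Submodule.span K (v '' ↑t)) :
    ∃ B : Finset ι, s ⊆ B ∧ B ⊆ t ∧ B.card = 9 ∧ LinearIndepOn K v B := by
  classical
  obtain ⟨b, hbt, hsb, hspan, hli⟩ := exists_linearIndepOn_extension hs (Finset.coe_subset.2 hst)
  have hspan' : Submodule.span K (Set.range fun x : b => v x) = ⊤ := by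
    rw [← Set.image_eq_range]
    exact top_le_iff.1 (ht.trans (Submodule.span_le.2 hspan))
  have hli' : LinearIndependent K (fun x : b => v x) := hli
  have hcardb : Fintype.card b = 9 := by
    have h1 := finrank_span_eq_card hli'
    rw [hspan', finrank_top, finrank_Mat3] at h1
    exact h1.symm
  refine ⟨b.toFinset, fun x hx => ?_, fun x hx => ?_, by rw [Set.toFinset_card]; exact hcardb,
    by simpa using hli⟩
  · exact Set.mem_toFinset.2 (hsb (Finset.mem_coe.2 hx))
  · exact Finset.mem_coe.1 (hbt (Set.mem_toFinset.1 hx))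

/-- A 9-element independent subfamily spans `K^{3×3}`. [folklore] -/
theorem span_block_eq_top {ι : Type*} (v : ι → Mat3 K) {B : Finset ι} (hB : B.card = 9)
    (hli : LinearIndepOn K v B) : Submodule.span K (v '' ↑B) = ⊤ := by
  classical
  have hli' : LinearIndependent K (fun x : (↑B : Set ι) => v x) := hli
  rw [Set.image_eq_range]
  exact hli'.span_eq_top_of_card_eq_finrank'
    (by rw [Fintype.card_of_subtype B fun x => Finset.mem_coe.symm, hB, finrank_Mat3])

/-- If the `v_ρ, ρ ∈ B` span `K^{3×3}`, a matrix pairing to zero with all of them vanishes.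
[folklore] -/
theorem eq_zero_of_frob_block {ι : Type*} (v : ι → Mat3 K) {B : Finset ι}
    (hB : Submodule.span K (v '' ↑B) = ⊤) {u : Mat3 K} (hu : ∀ ρ ∈ B, frob (v ρ) u = 0) :
    u = 0 := by
  refine eq_zero_of_frob_left fun A => ?_
  have key : ∀ z ∈ Submodule.span K (v '' ↑B), frob z u = 0 := by
    intro z hz
    induction hz using Submodule.span_induction with
    | mem x hx =>
      obtain ⟨ρ, hρ, rfl⟩ := hx
      exact hu ρ (Finset.mem_coe.1 hρ)
    | zero => simp
    | add x y _ _ hx hy => rw [frob_add_left, hx, hy, add_zero]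
    | smul c x _ hx => rw [frob_smul_left, hx, mul_zero]
  exact key A (by rw [hB]; trivial)

/-! ## The pencil argument (the only use of algebraic closure) -/

/-- Over an algebraically closed field every pencil `s A + t B` of `3 × 3` matrices contains a
singular member with `(s, t) ≠ 0` (an eigenvalue of `B⁻¹ A`, or `B` itself). [folklore] -/
theorem exists_det_comb_eq_zero [IsAlgClosed K] (A B : Mat3 K) :
    ∃ s t : K, (s ≠ 0 ∨ t ≠ 0) ∧ (s • A + t • B).det = 0 := by
  by_cases hB : B.det = 0
  · exact ⟨0, 1, Or.inr one_ne_zero, by simpa using hB⟩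
  · have hBu : IsUnit B.det := isUnit_iff_ne_zero.2 hB
    set C := B⁻¹ * A with hC
    have hdeg : C.charpoly.degree ≠ 0 := by
      rw [Polynomial.degree_eq_natDegree C.charpoly_monic.ne_zero, charpoly_natDegree_eq_dim]
      simp
    obtain ⟨r, hr⟩ := IsAlgClosed.exists_root C.charpoly hdeg
    refine ⟨-1, r, Or.inl (by norm_num), ?_⟩
    have heval := Matrix.eval_charpoly C r
    rw [hr.eq_zero] at heval
    have key : (-1 : K) • A + r • B = B * (Matrix.scalar (Fin 3) r - C) := by
      rw [Matrix.mul_sub, hC, Matrix.mul_nonsing_inv_cancel_left B A hBu, Matrix.scalar_apply,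
        ← smul_eq_mul_diagonal]
      simp only [neg_smul, one_smul]
      abel
    rw [key, Matrix.det_mul, ← heval, mul_zero]

/-- Consequently a subspace of `K^{3×3}` of dimension `≥ 2` contains a nonzero singular matrix.
[folklore] -/
theorem exists_singular_of_two_le_finrank [IsAlgClosed K] (S : Submodule K (Mat3 K))
    (hS : 2 ≤ finrank K S) : ∃ Λ ∈ S, Λ ≠ 0 ∧ Λ.det = 0 := by
  have hpos : 0 < finrank K S := by omega
  obtain ⟨x, hx⟩ : ∃ x : S, x ≠ 0 := by
    by_contra! hall
    haveI : Subsingleton S := ⟨fun a b => by rw [hall a, hall b]⟩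
    have : finrank K S = 0 := Module.finrank_zero_of_subsingleton
    omega
  obtain ⟨y, hxy⟩ := exists_linearIndependent_pair_of_one_lt_finrank hS hx
  obtain ⟨s, t, hst, hdet⟩ := exists_det_comb_eq_zero (x : Mat3 K) (y : Mat3 K)
  refine ⟨s • (x : Mat3 K) + t • (y : Mat3 K), S.add_mem (S.smul_mem s x.2) (S.smul_mem t y.2),
    fun h0 => ?_, hdet⟩
  have h0' : s • x + t • y = 0 := by
    apply Subtype.ext
    simpa using h0
  obtain ⟨hs, ht⟩ := (LinearIndependent.pair_iff.1 hxy) s t h0'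
  rcases hst with h | h <;> contradiction

/-! ## Lemma 7, modified first step: eight `g_μ` whose common zeros are singular -/

section Lemma7

variable {ι : Type*} [Fintype ι] [DecidableEq ι] {F G W : ι → Mat3 K}

/-- **Modified first step of Bläser 2003, Lemma 7** (block sizes `3 + 8 + 7` instead of Lemma 6):
given a 9-block `B` on which the `F_ρ` form a basis, there is an 8-set `Mid` of indices such
that every nonzero `c` killed by the `g_μ, μ ∈ Mid` is singular.
[cite: Blaser2003, Lemma 7 (proof, first goal)] -/
theorem exists_mid [IsAlgClosed K] (h : IsComp F G W) (hcard : Fintype.card ι = 18)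
    {B : Finset ι} (hBcard : B.card = 9) (hBli : LinearIndepOn K F B) :
    ∃ Mid : Finset ι, Mid.card ≤ 8 ∧
      ∀ c : Mat3 K, (∀ μ ∈ Mid, frob (G μ) c = 0) → c ≠ 0 → c.det = 0 := by
  classical
  -- `T ⊆ Bᶜ`, `|T| = 7`
  obtain ⟨T, hTB, hTcard⟩ := Finset.exists_subset_card_eq
    (show 7 ≤ Bᶜ.card by rw [Finset.card_compl, hcard, hBcard]; norm_num)
  -- a nonzero singular `Λ` orthogonal to the `W_ρ`, `ρ ∈ T`
  let e : Mat3 K →ₗ[K] (T → K) :=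
    { toFun := fun Λ ρ => frob Λ (W ρ)
      map_add' := by intro x y; ext ρ; simp [frob_add_left]
      map_smul' := by intro a x; ext ρ; simp [frob_smul_left] }
  have hker : 2 ≤ finrank K (LinearMap.ker e) := by
    have h1 := e.finrank_range_add_finrank_ker
    have h2 : finrank K (LinearMap.range e) ≤ 7 :=
      (Submodule.finrank_le _).trans (by simp [Module.finrank_fintype_fun_eq_card, hTcard])
    rw [finrank_Mat3] at h1
    omega
  obtain ⟨Λ, hΛker, hΛ0, hΛdet⟩ := exists_singular_of_two_le_finrank _ hker
  have hΛW : ∀ ρ (hρ : ρ ∈ T), frob Λ (W ρ) = 0 := fun ρ hρ =>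
    congr_fun (LinearMap.mem_ker.1 hΛker) ⟨ρ, hρ⟩
  obtain ⟨v, hv0, hvΛ⟩ := Matrix.exists_vecMul_eq_zero_iff.2 hΛdet
  -- `Z = Λ^⊥ ⊇ R' = v K^{1×3}`
  let Z : Submodule K (Mat3 K) := LinearMap.ker (frobForm Λ)
  have memZ : ∀ x, x ∈ Z ↔ frob Λ x = 0 := fun x => by simp [Z]
  let R' : Submodule K (Mat3 K) := LinearMap.range (rk1 v)
  have hR'Z : R' ≤ Z := by
    rintro _ ⟨c, rfl⟩
    rw [memZ]
    have hj : ∀ j, ∑ i, v i * Λ i j = 0 := fun j => by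
      have := congr_fun hvΛ j
      simpa [Matrix.vecMul, dotProduct] using this
    calc frob Λ (rk1 v c) = ∑ j, (∑ i, v i * Λ i j) * c j := by
          simp only [frob, rk1, LinearMap.coe_mk, AddHom.coe_mk, vecMulVec_apply, Finset.sum_mul]
          rw [Finset.sum_comm]
          exact Finset.sum_congr rfl fun j _ => Finset.sum_congr rfl fun i _ => by ring
      _ = 0 := by simp [hj]
  have hR'mul : ∀ u ∈ R', ∀ c : Mat3 K, u * c ∈ R' := by
    rintro _ ⟨d, rfl⟩ c
    refine ⟨d ᵥ* c, ?_⟩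
    ext i j
    simp [rk1, vecMulVec_apply, Matrix.mul_apply, Matrix.vecMul, dotProduct, Finset.mul_sum,
      mul_assoc]
  have hR'rank : finrank K R' = 3 := by
    have hinj : Function.Injective (rk1 v) := by
      obtain ⟨i₀, hi₀⟩ : ∃ i, v i ≠ 0 := by
        by_contra! hall
        exact hv0 (funext hall)
      intro c d hcd
      ext j
      have := congr_fun (congr_fun hcd i₀) j
      simp only [rk1, LinearMap.coe_mk, AddHom.coe_mk, vecMulVec_apply] at this
      exact mul_left_cancel₀ hi₀ this
    rw [LinearMap.finrank_range_of_inj hinj]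
    simp
  -- the `F`-block: three `f_ρ, ρ ∈ F₀ ⊆ B` forming a basis of `R'^*`
  have hBspan := span_block_eq_top F hBcard hBli
  have hJ : ∀ u ∈ R', (∀ ρ ∈ B, fF F ρ u = 0) → u = 0 := fun u _ hu =>
    eq_zero_of_frob_block F hBspan fun ρ hρ => by simpa using hu ρ hρ
  obtain ⟨F₀, hF₀B, hF₀sep, hsolve⟩ := BilinComp.exists_subset_forall_exists_eq R' B (fF F) hJ
  have hF₀card : 3 ≤ F₀.card := by
    rw [← hR'rank]
    exact BilinComp.finrank_le_card_of_forall_eq_zero R' F₀ (fF F) hF₀sep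
  -- the middle block
  refine ⟨(F₀ ∪ T)ᶜ, ?_, fun c hc hc0 => ?_⟩
  · have hdisj : Disjoint F₀ T := Finset.disjoint_left.2 fun ρ hρF hρT =>
      (Finset.mem_compl.1 (hTB hρT)) (hF₀B hρF)
    rw [Finset.card_compl, Finset.card_union_of_disjoint hdisj, hcard, hTcard]
    omega
  · by_contra hdet
    have hcu : IsUnit c.det := isUnit_iff_ne_zero.2 hdet
    have hbc : ∀ b : Mat3 K, b * c ∈ Z := by
      intro b
      obtain ⟨t, htR, ht⟩ := hsolve fun ρ => frob (F ρ) b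
      have h1 : (b - t) * c ∈ Z := by
        rw [h (b - t) c, memZ, frob_sum_right]
        refine Finset.sum_eq_zero fun ρ _ => ?_
        rw [frob_smul_right]
        by_cases hρF : ρ ∈ F₀
        · have : frob (F ρ) t = frob (F ρ) b := by simpa using ht ρ hρF
          simp [frob_sub_right, this]
        · by_cases hρT : ρ ∈ T
          · simp [hΛW ρ hρT]
          · have hρM : ρ ∈ (F₀ ∪ T)ᶜ := by simp [hρF, hρT]
            simp [hc ρ hρM]
      have h2 : t * c ∈ Z := hR'Z (hR'mul t htR c)
      simpa [sub_mul] using Z.add_mem h1 h2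
    obtain ⟨i, j, hij⟩ := exists_apply_ne_zero hΛ0
    have := hbc (single i j 1 * c⁻¹)
    rw [Matrix.mul_assoc, Matrix.nonsing_inv_mul c hcu, Matrix.mul_one, memZ,
      frob_single_right] at this
    exact hij this

/-- **Bläser 2003, Lemma 7, the dual basis vector `y_M`**: there are a 9-block `Gs` of indices on
which the `G_μ` form a basis of `K^{3×3}`, an index `ρ₉ ∈ Gs` and a nonzero SINGULAR `y₉`
(the `ρ₉`-th dual basis vector) with `⟪G_μ, y₉⟫ = 0` for all `μ ∈ Gs ∖ {ρ₉}`.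
[cite: Blaser2003, Lemma 7 (proof)] -/
theorem exists_y9 (h : IsComp F G W) {Mid : Finset ι} (hMid : Mid.card ≤ 8)
    (hsing : ∀ c : Mat3 K, (∀ μ ∈ Mid, frob (G μ) c = 0) → c ≠ 0 → c.det = 0) :
    ∃ (Gs : Finset ι) (ρ9 : ι) (y9 : Mat3 K), Gs.card = 9 ∧ LinearIndepOn K G Gs ∧ ρ9 ∈ Gs ∧
      y9 ≠ 0 ∧ y9.det = 0 ∧ ∀ μ ∈ Gs, μ ≠ ρ9 → frob (G μ) y9 = 0 := by
  classical
  -- `G₀ ⊆ Mid`: a basis of `span {G_μ | μ ∈ Mid}`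
  obtain ⟨b, hbMid, -, hspan, hli⟩ :=
    exists_linearIndepOn_extension (linearIndepOn_empty K G) (Set.empty_subset (Mid : Set ι))
  have hG₀Mid : b.toFinset ⊆ Mid := fun x hx => Finset.mem_coe.1 (hbMid (Set.mem_toFinset.1 hx))
  have hli₀ : LinearIndepOn K G (b.toFinset : Set ι) := by simpa using hli
  have hspan₀ : ∀ μ ∈ Mid, G μ ∈ Submodule.span K (G '' ↑b.toFinset) := fun μ hμ => by
    rw [Set.coe_toFinset]; exact hspan ⟨μ, Finset.mem_coe.2 hμ, rfl⟩
  -- extend inside `G₀ ∪ Midᶜ` to a 9-block `Gs`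
  have ht' : ⊤ ≤ Submodule.span K (G '' ↑(b.toFinset ∪ Midᶜ)) := by
    rw [← h.span_G, Submodule.span_le]
    rintro _ ⟨ρ, rfl⟩
    by_cases hρ : ρ ∈ Mid
    · refine Submodule.span_mono (Set.image_mono ?_) (hspan₀ ρ hρ)
      rw [Finset.coe_union]
      exact Set.subset_union_left
    · exact Submodule.subset_span ⟨ρ, by simp [hρ], rfl⟩
  obtain ⟨Gs, hG₀Gs, hGst, hGscard, hGsli⟩ :=
    exists_block_extension G hli₀ Finset.subset_union_left ht'
  -- `ρ₉ ∈ Gs ∖ G₀`, hence `ρ₉ ∉ Mid`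
  have hlt : b.toFinset.card < Gs.card := by
    have := Finset.card_le_card hG₀Mid
    omega
  obtain ⟨ρ9, hρ9⟩ : (Gs \ b.toFinset).Nonempty := by
    rw [← Finset.card_pos, Finset.card_sdiff_of_subset hG₀Gs]
    omega
  rw [Finset.mem_sdiff] at hρ9
  -- the dual basis of the basis `(G_μ)_{μ ∈ Gs}` w.r.t. the trace pairing
  have hGsli' : LinearIndependent K (fun x : Gs => G x) := hGsli
  let bG : Basis Gs K (Mat3 K) :=
    basisOfLinearIndependentOfCardEqFinrank' _ hGsli' (by simp [hGscard, finrank_Mat3])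
  let y : Basis Gs K (Mat3 K) := frobForm.dualBasis frobForm_nondegenerate bG
  have hy : ∀ μ ν : Gs, frob (G μ) (y ν) = if μ = ν then 1 else 0 := fun μ ν => by
    have := LinearMap.BilinForm.apply_dualBasis_left (B := frobForm) frobForm_nondegenerate bG ν μ
    rw [frobForm_apply, frob_comm] at this
    simpa [bG] using this
  have hy' : ∀ μ ∈ Gs, μ ≠ ρ9 → frob (G μ) (y ⟨ρ9, hρ9.1⟩) = 0 := fun μ hμ hne => by
    have := hy ⟨μ, hμ⟩ ⟨ρ9, hρ9.1⟩
    simpa [hne] using this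
  refine ⟨Gs, ρ9, y ⟨ρ9, hρ9.1⟩, hGscard, hGsli, hρ9.1, y.ne_zero _, ?_, hy'⟩
  -- `y₉` is killed by every `G_μ, μ ∈ Mid` (they lie in `span G(G₀)`, `G₀ ⊆ Gs ∖ {ρ₉}`)
  refine hsing _ (fun μ hμ => ?_) (y.ne_zero _)
  have key : ∀ z ∈ Submodule.span K (G '' ↑b.toFinset), frob z (y ⟨ρ9, hρ9.1⟩) = 0 := by
    intro z hz
    induction hz using Submodule.span_induction with
    | mem x hx =>
      obtain ⟨j, hj, rfl⟩ := hx
      have hj' : j ∈ b.toFinset := Finset.mem_coe.1 hj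
      exact hy' j (hG₀Gs hj') fun e => hρ9.2 (e ▸ hj')
    | zero => simp
    | add x x' _ _ hx hx' => rw [frob_add_left, hx, hx', add_zero]
    | smul c x _ hx => rw [frob_smul_left, hx, mul_zero]
  exact key _ (hspan₀ μ hμ)

/-- **Bläser 2003, Lemma 7** (`n = m = 3`, `r = 18`, with the modified first step): if there is
a computation of length `18` for `⟨3,3,3⟩` over an algebraically closed field then there is one,
`(F', G', W')`, together with a 9-block `Gs` on which the `G'_μ` form a basis of `K^{3×3}`, an
index `ρs ∉ Gs` and a nonzero singular `a` with `⟪F'_μ, a⟫ = 0` for all `μ ∉ Gs ∪ {ρs}`.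
[cite: Blaser2003, Lemma 7] -/
theorem lemma7 [IsAlgClosed K] (hcard : Fintype.card ι = 18) (h : IsComp F G W) :
    ∃ F' G' W' : ι → Mat3 K, IsComp F' G' W' ∧ ∃ (Gs : Finset ι) (ρs : ι) (a : Mat3 K),
      Gs.card = 9 ∧ LinearIndepOn K G' Gs ∧ ρs ∉ Gs ∧ a ≠ 0 ∧ a.det = 0 ∧
      ∀ μ, μ ∉ Gs → μ ≠ ρs → frob (F' μ) a = 0 := by
  classical
  have he : LinearIndepOn K F (↑(∅ : Finset ι)) := by
    rw [Finset.coe_empty]; exact linearIndepOn_empty K F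
  obtain ⟨B, -, -, hBcard, hBli⟩ := exists_block_extension F he
    (Finset.empty_subset Finset.univ) (by simp [h.span_F])
  obtain ⟨Mid, hMid, hsing⟩ := exists_mid h hcard hBcard hBli
  obtain ⟨Gs, ρ9, y9, hGscard, hGsli, hρ9, hy0, hydet, hyG⟩ := exists_y9 h hMid hsing
  by_cases hcase : ∃ a : Mat3 K, a ≠ 0 ∧ ∀ ρ, (ρ ∉ Gs ∨ ρ = ρ9) → frob (F ρ) a = 0
  · -- case (i): `dim span{f_ρ | ρ ∉ Gs ∨ ρ = ρ₉} ≤ 8`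
    obtain ⟨a, ha0, ha⟩ := hcase
    have hay : a * y9 = 0 := by
      rw [h a y9]
      refine Finset.sum_eq_zero fun ρ _ => ?_
      by_cases hρ : ρ ∈ Gs
      · by_cases hρ9' : ρ = ρ9
        · simp [ha ρ (Or.inr hρ9')]
        · simp [hyG ρ hρ hρ9']
      · simp [ha ρ (Or.inl hρ)]
    have hadet : a.det = 0 := by
      by_contra hdet
      refine hy0 ?_
      rw [← Matrix.nonsing_inv_mul_cancel_left a y9 (isUnit_iff_ne_zero.2 hdet), hay,
        Matrix.mul_zero]
    obtain ⟨ρs, hρs⟩ : (Gsᶜ).Nonempty := by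
      rw [← Finset.card_pos, Finset.card_compl, hcard, hGscard]; norm_num
    exact ⟨F, G, W, h, Gs, ρs, a, hGscard, hGsli, Finset.mem_compl.1 hρs, ha0, hadet,
      fun μ hμ _ => ha μ (Or.inl hμ)⟩
  · -- case (ii): those ten `f_ρ` span; pick a basis `B'` among them and transpose
    push Not at hcase
    set B'' : Finset ι := insert ρ9 Gsᶜ with hB''
    have hmemB'' : ∀ ρ, ρ ∈ B'' ↔ (ρ ∉ Gs ∨ ρ = ρ9) := fun ρ => by
      rw [hB'', Finset.mem_insert, Finset.mem_compl, or_comm]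
    have hB''card : B''.card = 10 := by
      rw [hB'', Finset.card_insert_of_notMem (by simpa using hρ9), Finset.card_compl, hcard,
        hGscard]
    have hspan'' : ⊤ ≤ Submodule.span K (F '' ↑B'') := by
      have := span_eq_top_of_forall_frob (fun ρ : (↑B'' : Set ι) => F ρ) fun z hz => by
        obtain ⟨ρ, hρ, hne⟩ := hcase z hz
        exact ⟨⟨ρ, Finset.mem_coe.2 ((hmemB'' ρ).2 hρ)⟩, hne⟩
      rw [Set.image_eq_range, this]
    obtain ⟨B', -, hB'sub, hB'card, hB'li⟩ := exists_block_extension F he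
      (Finset.empty_subset B'') hspan''
    have hsd : (B'' \ B').card = 1 := by
      rw [Finset.card_sdiff_of_subset hB'sub, hB''card, hB'card]
    obtain ⟨ρs, hρs⟩ := Finset.card_eq_one.1 hsd
    have hρs' : ρs ∈ B'' ∧ ρs ∉ B' := by
      rw [← Finset.mem_sdiff, hρs]; exact Finset.mem_singleton_self ρs
    have huniq : ∀ μ ∈ B'', μ ∉ B' → μ = ρs := fun μ h1 h2 => by
      have : μ ∈ B'' \ B' := Finset.mem_sdiff.2 ⟨h1, h2⟩
      rw [hρs] at this
      exact Finset.mem_singleton.1 this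
    refine ⟨fun ρ => (G ρ)ᵀ, fun ρ => (F ρ)ᵀ, fun ρ => (W ρ)ᵀ, h.transpose, B', ρs, y9ᵀ, hB'card,
      ?_, hρs'.2, fun h0 => hy0 (by simpa using congrArg Matrix.transpose h0),
      by rwa [Matrix.det_transpose], ?_⟩
    · have hB'li' : LinearIndependent K (fun x : B' => F x) := hB'li
      have := hB'li'.map' (Matrix.transposeLinearEquiv (Fin 3) (Fin 3) K K).toLinearMap
        (LinearEquiv.ker _)
      exact this
    · intro μ hμB' hμρs
      rw [frob_transpose]
      have hμB'' : μ ∉ B'' := fun hm => hμρs (huniq μ hm hμB')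
      rw [hmemB''] at hμB''
      push Not at hμB''
      exact hyG μ (by simpa using hμB''.1) hμB''.2

end Lemma7

end Blaser2003

end Literature.Computability.AlgebraicComplexity
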